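import Summits.Ventures.CertifiedArithmetic.LowPrec.DoubleRoundingProductStrip

/-!
# The gap below a coarse grid point, and rounding just below a general midpoint

HONEST FRAMING: certified error envelopes and provably optimal rounding/accumulation schemes for
low-precision formats under stated cost models; every table by two implementations; no hardware
or vendor claims.

Two single-format lemmas used by the record-generic double-rounding witnesses FROM BELOW
(`DoubleRoundingGmidBelow.lean`, `DoubleRoundingSqrtStrip.lean`):

* `le_sub_pow_of_lt` — below a multiple `N` of `2^g` quanta with `2^(m+g) + 2^g ≤ N`, every
  value of a format is at most `N - 2^g` quanta (data of magnitude `≥ 2^(m+g)` are multiples of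
  `2^g`, smaller ones are below `N - 2^g` anyway; no range hypothesis on `N`), specialised to
  the lower neighbour `t·2^(k+1)` of a general midpoint in `le_sub_pow_of_lt_gmid`;
* `toRat_roundNE_below_gmid` — `fl_φ ((2t+1)·2^k · quantum - δ) = t·2^(k+1)` quanta for
  `0 < δ < 2^k · quantum`, the mirror image of
  `DoubleRoundingProductStrip.toRat_roundNE_above_gmid`.

References: [BoldoMelquiond2008] §III.A (divisibility along the grid);
[MartinDorelMelquiondMuller2013] Property 2.1.
-/

namespace Summit.Ventures.CertifiedArithmetic

open Literature.ComputerArithmetic.FloatingPoint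
open Literature.ComputerArithmetic.FloatingPoint.Format
open Literature.ComputerArithmetic.FloatingPoint.MiniFloat

/-! ## §1 The gap below a coarse multiple -/

/-- GAP BELOW: if `2^g ∣ N` and `2^(m+g) + 2^g ≤ N`, every value of `φ` strictly below `N`
quanta is at most `N - 2^g` quanta (data of magnitude `≥ 2^(m+g)` are multiples of `2^g`;
smaller ones are below `N - 2^g` anyway).  No range hypothesis on `N`. [folklore] -/
theorem le_sub_pow_of_lt {φ : Format} {N g : ℕ} (hd : 2 ^ g ∣ N)
    (hlo : 2 ^ (φ.manBits + g) + 2 ^ g ≤ N) (y : MiniFloat φ)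
    (hy : y.toRat < (N : ℚ) * φ.quantum) :
    y.toRat ≤ ((N - 2 ^ g : ℕ) : ℚ) * φ.quantum := by
  have hq := φ.quantum_pos
  have hgN : 2 ^ g ≤ N := le_trans (Nat.le_add_left _ _) hlo
  have hcast : ((N - 2 ^ g : ℕ) : ℚ) = (N : ℚ) - 2 ^ g := by
    rw [Nat.cast_sub hgN]; push_cast; ring
  by_cases hy0 : 0 ≤ y.toRat
  · have hval : y.toRat = (y.scaledMag : ℚ) * φ.quantum := by
      rw [toRat_eq_toInt_mul, toInt_eq_scaledMag_of_nonneg hy0]; push_cast; ring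
    have hlt : y.scaledMag < N := by
      have h1 : (y.scaledMag : ℚ) * φ.quantum < (N : ℚ) * φ.quantum := by
        rw [← hval]; exact hy
      exact_mod_cast lt_of_mul_lt_mul_right h1 hq.le
    suffices hS : y.scaledMag + 2 ^ g ≤ N by
      rw [hval, hcast]
      have h2 : (y.scaledMag : ℚ) + 2 ^ g ≤ N := by exact_mod_cast hS
      nlinarith
    by_cases hbig : 2 ^ (φ.manBits + g) ≤ y.scaledMag
    · -- a datum of magnitude `≥ 2^(m+g)` is a multiple of `2^g`
      have hdy : 2 ^ g ∣ y.scaledMag := by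
        rcases Nat.eq_zero_or_pos g with h0 | hpos
        · rw [h0, pow_zero]; exact one_dvd _
        · obtain ⟨g', rfl⟩ : ∃ g', g = g' + 1 := ⟨g - 1, by omega⟩
          have he : g' + 1 ≤ y.expCode - 1 := by
            apply succ_le_ulpExp_of_le_scaledMag (k := g')
            rw [show φ.manBits + 1 + g' = φ.manBits + (g' + 1) by ring]; exact hbig
          exact dvd_trans (pow_dvd_pow 2 he) (pow_ulpExp_dvd_scaledMag y)
      obtain ⟨a, ha⟩ := hdy
      obtain ⟨b, hb⟩ := hd
      rw [ha, hb] at hlt ⊢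
      have hab : a + 1 ≤ b := Nat.lt_of_mul_lt_mul_left hlt
      calc 2 ^ g * a + 2 ^ g = 2 ^ g * (a + 1) := by ring
        _ ≤ 2 ^ g * b := Nat.mul_le_mul_left _ hab
    · push Not at hbig
      omega
  · push Not at hy0
    have h0 : (0 : ℚ) ≤ ((N - 2 ^ g : ℕ) : ℚ) * φ.quantum := by positivity
    linarith

/-- The gap below the LOWER neighbour `t·2^(k+1)` of a general midpoint (`2^m ≤ t`): every
value of `φ` strictly below it is at most `t·2^(k+1) - 2^k` quanta. -/
theorem le_sub_pow_of_lt_gmid {φ : Format} {t k : ℕ} (htlo : 2 ^ φ.manBits ≤ t)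
    (y : MiniFloat φ) (hy : y.toRat < ((t * 2 ^ (k + 1) : ℕ) : ℚ) * φ.quantum) :
    y.toRat ≤ ((t * 2 ^ (k + 1) : ℕ) : ℚ) * φ.quantum - 2 ^ k * φ.quantum := by
  have hd : 2 ^ k ∣ t * 2 ^ (k + 1) := ⟨2 * t, by rw [pow_succ]; ring⟩
  have hlo : 2 ^ (φ.manBits + k) + 2 ^ k ≤ t * 2 ^ (k + 1) := by
    have h1 : 2 ^ φ.manBits * 2 ^ k ≤ t * 2 ^ k := Nat.mul_le_mul_right _ htlo
    have h2 : 2 ^ k ≤ 2 ^ φ.manBits * 2 ^ k := Nat.le_mul_of_pos_left _ (Nat.two_pow_pos _)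
    calc 2 ^ (φ.manBits + k) + 2 ^ k ≤ 2 ^ φ.manBits * 2 ^ k + t * 2 ^ k := by
          rw [pow_add]; omega
      _ ≤ t * 2 ^ k + t * 2 ^ k := by omega
      _ = t * 2 ^ (k + 1) := by rw [pow_succ]; ring
  have h := le_sub_pow_of_lt hd hlo y hy
  have hcast :
      ((t * 2 ^ (k + 1) - 2 ^ k : ℕ) : ℚ) = ((t * 2 ^ (k + 1) : ℕ) : ℚ) - 2 ^ k := by
    rw [Nat.cast_sub (le_trans (Nat.le_add_left _ _) hlo)]; push_cast; ring
  rw [hcast] at h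
  linarith

/-! ## §2 Rounding just below a general midpoint -/

/-- BELOW THE MIDPOINT GOES DOWN: `fl_φ ((2t+1)·2^k · quantum - δ) = t·2^(k+1)` quanta for
`0 < δ < 2^k · quantum` (the unique nearest value; `δ` is any rational). -/
theorem toRat_roundNE_below_gmid {φ : Format} {t k : ℕ} (htlo : 2 ^ φ.manBits ≤ t)
    (hthi : t < 2 ^ (φ.manBits + 1)) (hu : (t + 1) * 2 ^ (k + 1) ≤ φ.maxScaled) {δ : ℚ}
    (hδ0 : 0 < δ) (hδ : δ < 2 ^ k * φ.quantum) :
    (roundNE φ ((((2 * t + 1) * 2 ^ k : ℕ) : ℚ) * φ.quantum - δ)).toRat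
      = ((t * 2 ^ (k + 1) : ℕ) : ℚ) * φ.quantum := by
  have hq := φ.quantum_pos
  obtain ⟨hr0, hru⟩ := representable_gmid hthi hu
  obtain ⟨v0, hv0⟩ := exists_toRat_eq_natMul hr0
  obtain ⟨yu, hyu⟩ := exists_toRat_eq_natMul hru
  rw [← hv0]
  apply toRat_roundNE_eq_of_forall_lt ⟨v0, rfl⟩
  intro y hy
  set x := (((2 * t + 1) * 2 ^ k : ℕ) : ℚ) * φ.quantum - δ with hx
  set T := (2 : ℚ) ^ k * φ.quantum with hT
  have exv : x - v0.toRat = T - δ := by rw [hx, hv0]; push_cast; ring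
  have exu : x - yu.toRat = -T - δ := by rw [hx, hyu]; push_cast; ring
  rw [exv, abs_of_pos (by linarith)]
  rcases gap_gmid htlo hv0 y with h | h
  · rw [← hv0] at h
    have h' : y.toRat < v0.toRat := lt_of_le_of_ne h hy
    have hgap := le_sub_pow_of_lt_gmid htlo y (by rw [← hv0]; exact h')
    rw [← hv0] at hgap
    rw [abs_of_pos (by linarith)]
    linarith
  · rw [← hyu] at h
    rw [abs_of_nonpos (by linarith)]
    linarith

end Summit.Ventures.CertifiedArithmetic
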